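import Summits.Parity.GeneralizedHardyLittlewood.Theorems.FordMaynardNoSieveConst0164NegWitness0164Explicit

/-!
# Route `FordMaynardNoSieveConst0164`, crux `NegWitness0164` (stmt-Parity-19102), line `birth`,
# stub `stub_tweakNeg0164`: the witness assembled from a dimension-5 table

Helper file toward the certificate stub (K. Ford, J. Maynard, *On the theory of prime producing sieves*,
arXiv:2407.14368, §8).  The low-dimensional part of every witness of the Ford–Maynard / class-R shape is fixed:
`F₀⁽³⁾ = F₀⁽⁴⁾ = -𝟙[ν ≤ xᵢ < 1/2, Σ x = 1]` (`ν = 41/250`).  Given ANY dimension-5 table `G` (a function on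
vectors, zero outside dimension 5, symmetric, piecewise Lipschitz, nonnegative, supported on `{x ≥ ν, Σ x = 1}`, zero
at vectors with a pair summing to `≥ 1/2`) we assemble `F₀ = L + G` and prove every shape hypothesis of
`stub_tweakNeg0164_of_explicit` (`…Explicit`), leaving exactly the two numerical inequalities (I), (II) about `G`:

* `isPolyhedral_simplexBox`, `isPiecewiseLipschitz_const_simplexBox` — constants on `[lo, hi)^k ∩ {Σ x = 1}` are
  piecewise Lipschitz (Definition 6.2 (b));
* `lowPart` lemmas for `L k x = 𝟙[k ∈ {3,4}] · (-𝟙[ν ≤ xᵢ < 1/2, Σ x = 1])` (written as a lambda; no definition);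
* `stub_tweakNeg0164_of_table` — **the stub from a dimension-5 table `G` and the two inequalities (I), (II)**.

Def-free.  References: [FordMaynard2024PrimeSieves] arXiv:2407.14368, §8 (proof of Theorem 2.7 (c)), Definition 6.2.
-/

noncomputable section

open Finset MeasureTheory Set
open scoped Classical
open Literature.NumberTheory.Sieve Literature.NumberTheory.Sieve.FordMaynard

namespace Summit.Parity.GeneralizedHardyLittlewood.FordMaynardNoSieveConst0164NegWitness0164

/-- `[lo, hi)^k ∩ {Σ x = 1}` is polyhedral. [folklore] -/
theorem isPolyhedral_simplexBox (k : ℕ) (lo hi : ℝ) :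
    IsPolyhedral {x : Fin k → ℝ | (∀ i, lo ≤ x i ∧ x i < hi) ∧ ∑ i, x i = 1} := by
  refine IsPolyhedral.setOf_and (isPolyhedral_halfOpenBox k (fun _ => lo) (fun _ => hi)) ?_
  set φ : (Fin k → ℝ) →ₗ[ℝ] ℝ := ∑ t, LinearMap.proj t with hφ
  have hφapp : ∀ ξ : Fin k → ℝ, φ ξ = ∑ t, ξ t := fun ξ => by rw [hφ, LinearMap.sum_apply]; rfl
  have := (isPolyhedral_le φ 1).inter (isPolyhedral_ge φ 1)
  convert this using 1
  ext ξ
  simp only [Set.mem_setOf_eq, Set.mem_inter_iff, hφapp]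
  constructor
  · intro h; exact ⟨h.le, h.ge⟩
  · intro h; exact le_antisymm h.1 h.2

/-- **A constant on `[lo, hi)^k ∩ {Σ x = 1}` is piecewise Lipschitz** (one convex polytope).
[cite: FordMaynard2024PrimeSieves, Definition 6.2 (b)] -/
theorem isPiecewiseLipschitz_const_simplexBox (k : ℕ) (lo hi c : ℝ) :
    IsPiecewiseLipschitz (fun x : Fin k → ℝ => if (∀ i, lo ≤ x i ∧ x i < hi) ∧ ∑ i, x i = 1 then c else 0) := by
  refine IsPiecewiseLipschitz'.isPiecewiseLipschitz ?_
  refine ⟨Unit, inferInstance, fun _ => {x : Fin k → ℝ | (∀ i, lo ≤ x i ∧ x i < hi) ∧ ∑ i, x i = 1},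
    fun _ x => if (∀ i, lo ≤ x i ∧ x i < hi) ∧ ∑ i, x i = 1 then c else 0,
    fun _ => ⟨isPolyhedral_simplexBox k lo hi,
      (isBounded_halfOpenBox k (fun _ => lo) (fun _ => hi)).subset fun x hx => hx.1,
      fun x hx => if_neg hx, ⟨0, ?_⟩⟩, fun x => by simp⟩
  refine LipschitzOnWith.of_dist_le_mul fun x hx y hy => ?_
  have hx' : (∀ i, lo ≤ x i ∧ x i < hi) ∧ ∑ i, x i = 1 := hx
  have hy' : (∀ i, lo ≤ y i ∧ y i < hi) ∧ ∑ i, y i = 1 := hy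
  show dist (if (∀ i, lo ≤ x i ∧ x i < hi) ∧ ∑ i, x i = 1 then c else 0)
    (if (∀ i, lo ≤ y i ∧ y i < hi) ∧ ∑ i, y i = 1 then c else 0) ≤ _
  rw [if_pos hx', if_pos hy', dist_self]
  simp

/-- The zero function is piecewise Lipschitz. [folklore] -/
theorem isPiecewiseLipschitz_zero (k : ℕ) : IsPiecewiseLipschitz (fun _ : Fin k → ℝ => (0 : ℝ)) :=
  IsPiecewiseLipschitz'.zero.isPiecewiseLipschitz

/-- Sums of piecewise Lipschitz functions are piecewise Lipschitz. [folklore] -/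
theorem isPiecewiseLipschitz_add {k : ℕ} {f g : (Fin k → ℝ) → ℝ} (hf : IsPiecewiseLipschitz f)
    (hg : IsPiecewiseLipschitz g) : IsPiecewiseLipschitz (fun x => f x + g x) :=
  (hf.isPiecewiseLipschitz'.add hg.isPiecewiseLipschitz').isPiecewiseLipschitz

/-- **`stub_tweakNeg0164` from a dimension-5 table.** Let `G` be a function on vectors vanishing outside dimension
`5`, whose dimension-5 part is symmetric, piecewise Lipschitz, nonnegative, supported on `{xᵢ ≥ 41/250, Σ x = 1}`
and zero at every vector with two coordinates summing to `≥ 1/2`. Put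
`F₀ = 𝟙[k ∈ {3,4}]·(-𝟙[41/250 ≤ xᵢ < 1/2, Σ x = 1]) + G`. If
(I) `J₃/3 + (1/20)∫_{Δ₅(1)} 𝟙[v ≥ ν] G(v)/∏v > 1` and
(II) for all `b ∈ [ν, 1/2)²`, `|b| ≤ 1/2`, `α = 1 - |b|`:
`(α/6)∫_{Δ₃(α)} 𝟙[v ≥ ν] G(v, b)/(v₀v₁v₂) ≤ 1 + (α/2)∫_{Δ₂(α)} 𝟙[ν ≤ vᵢ < 1/2]/(v₀v₁)`,
then `stub_tweakNeg0164` holds (with witness `F₀`).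
[cite: FordMaynard2024PrimeSieves, §8 (proof of Theorem 2.7 (c))] -/
theorem stub_tweakNeg0164_of_table (G : VecFn) (hG0 : ∀ k, k ≠ 5 → ∀ x, G k x = 0)
    (hGs : ∀ (σ : Equiv.Perm (Fin 5)) (x : Fin 5 → ℝ), G 5 (x ∘ σ) = G 5 x)
    (hGpl : IsPiecewiseLipschitz (G 5)) (hG5 : ∀ x, 0 ≤ G 5 x)
    (hGsupp : ∀ x, G 5 x ≠ 0 → (∀ i, (41 / 250 : ℝ) ≤ x i) ∧ ∑ i, x i = 1)
    (hGpair : ∀ (x : Fin 5 → ℝ) (i j : Fin 5), i ≠ j → 1 / 2 ≤ x i + x j → G 5 x = 0)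
    (hI : 1 < 1 / 3 * sliceIntegral 3 1 (fun v => if (∀ t, (41 / 250 : ℝ) ≤ v t) ∧ (∀ t, v t < 1 / 2) then
          1 / (v 0 * v 1 * v 2) else 0) +
        1 / 20 * sliceIntegral 5 1 (fun v => if ∀ t, (41 / 250 : ℝ) ≤ v t then
          G 5 v / (v 0 * v 1 * v 2 * v 3 * v 4) else 0))
    (hII : ∀ b : Fin 2 → ℝ, (∀ i, (41 / 250 : ℝ) ≤ b i) → (∀ i, b i < 1 / 2) → ∑ i, b i ≤ 1 / 2 →
      (1 - ∑ i, b i) / 6 * sliceIntegral 3 (1 - ∑ i, b i) (fun v => if ∀ t, (41 / 250 : ℝ) ≤ v t then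
          G (3 + 2) (Fin.append v b) / (v 0 * v 1 * v 2) else 0) ≤
        1 + (1 - ∑ i, b i) / 2 * sliceIntegral 2 (1 - ∑ i, b i) (fun v =>
          if (∀ i, (41 / 250 : ℝ) ≤ v i) ∧ (∀ i, v i < 1 / 2) then 1 / (v 0 * v 1) else 0)) :
    ∃ F₀ : VecFn, F₀.IsSymmetric ∧ (∀ k, IsPiecewiseLipschitz (F₀ k)) ∧
      (∀ (k : ℕ) (ξ : Fin k → ℝ), F₀ k ξ ≠ 0 → (∀ i, (41 / 250 : ℝ) ≤ ξ i) ∧ ∑ i, ξ i = 1) ∧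
      tweak (1 / 2) (41 / 250) Fin.elim0 Fin.elim0 F₀ 1 (fun _ => 1) < -1 ∧
      ∀ k : ℕ, 2 ≤ k → ∀ β : Fin k → ℝ, -1 ≤ tweak (1 / 2) (41 / 250) Fin.elim0 Fin.elim0 F₀ k β := by
  -- the low-dimensional part
  set L : VecFn := fun k x => if k = 3 ∨ k = 4 then
    (if (∀ i, (41 / 250 : ℝ) ≤ x i ∧ x i < 1 / 2) ∧ ∑ i, x i = 1 then (-1 : ℝ) else 0) else 0 with hL
  set F₀ : VecFn := fun k x => L k x + G k x with hF
  have hL34 : ∀ k, (k = 3 ∨ k = 4) → ∀ x : Fin k → ℝ,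
      L k x = if (∀ i, (41 / 250 : ℝ) ≤ x i ∧ x i < 1 / 2) ∧ ∑ i, x i = 1 then (-1 : ℝ) else 0 :=
    fun k hk x => by simp only [hL, if_pos hk]
  have hLz : ∀ k, ¬ (k = 3 ∨ k = 4) → ∀ x : Fin k → ℝ, L k x = 0 := fun k hk x => by simp only [hL, if_neg hk]
  -- F₀ in dimensions 3, 4, 5, and the others
  have hF3 : ∀ x : Fin 3 → ℝ, F₀ 3 x =
      if (∀ i, (41 / 250 : ℝ) ≤ x i ∧ x i < 1 / 2) ∧ ∑ i, x i = 1 then (-1 : ℝ) else 0 := fun x => by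
    simp only [hF, hL34 3 (Or.inl rfl), hG0 3 (by norm_num), add_zero]
  have hF4 : ∀ x : Fin 4 → ℝ, F₀ 4 x =
      if (∀ i, (41 / 250 : ℝ) ≤ x i ∧ x i < 1 / 2) ∧ ∑ i, x i = 1 then (-1 : ℝ) else 0 := fun x => by
    simp only [hF, hL34 4 (Or.inr rfl), hG0 4 (by norm_num), add_zero]
  have hF5 : ∀ x : Fin 5 → ℝ, F₀ 5 x = G 5 x := fun x => by
    simp only [hF, hLz 5 (by norm_num), zero_add]
  have hFz : ∀ k, k ≠ 3 → k ≠ 4 → k ≠ 5 → ∀ x : Fin k → ℝ, F₀ k x = 0 := fun k h3 h4 h5 x => by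
    simp only [hF, hLz k (by omega), hG0 k h5, add_zero]
  refine stub_tweakNeg0164_of_explicit F₀ ?_ ?_ ?_ ?_ ?_ ?_ ?_ ?_ ?_ ?_ ?_ ?_
  · -- symmetric
    intro k σ x
    by_cases hk : k = 3 ∨ k = 4
    · have hiff : ((∀ i, (41 / 250 : ℝ) ≤ (x ∘ σ) i ∧ (x ∘ σ) i < 1 / 2) ∧ ∑ i, (x ∘ σ) i = 1) ↔
          ((∀ i, (41 / 250 : ℝ) ≤ x i ∧ x i < 1 / 2) ∧ ∑ i, x i = 1) := by
        rw [show ∑ i, (x ∘ σ) i = ∑ i, x i from Equiv.sum_comp σ x]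
        exact and_congr ⟨fun h i => by simpa using h (σ.symm i), fun h i => h (σ i)⟩ Iff.rfl
      have hGk : ∀ y : Fin k → ℝ, G k y = 0 := fun y => hG0 k (by rcases hk with rfl | rfl <;> norm_num) y
      simp only [hF, hL34 k hk, hGk, hiff]
    · by_cases hk5 : k = 5
      · subst hk5
        rw [hF5, hF5, hGs]
      · rw [hFz k (fun h => hk (Or.inl h)) (fun h => hk (Or.inr h)) hk5,
          hFz k (fun h => hk (Or.inl h)) (fun h => hk (Or.inr h)) hk5]
  · -- piecewise Lipschitz
    intro k
    by_cases hk : k = 3 ∨ k = 4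
    · have hGk : ∀ y : Fin k → ℝ, G k y = 0 := fun y => hG0 k (by rcases hk with rfl | rfl <;> norm_num) y
      have : F₀ k = fun x => if (∀ i, (41 / 250 : ℝ) ≤ x i ∧ x i < 1 / 2) ∧ ∑ i, x i = 1 then (-1 : ℝ) else 0 := by
        funext x; simp only [hF, hL34 k hk, hGk, add_zero]
      rw [this]
      exact isPiecewiseLipschitz_const_simplexBox k _ _ _
    · by_cases hk5 : k = 5
      · subst hk5
        have : F₀ 5 = G 5 := funext hF5
        rw [this]; exact hGpl
      · have : F₀ k = fun _ => 0 := funext (hFz k (fun h => hk (Or.inl h)) (fun h => hk (Or.inr h)) hk5)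
        rw [this]; exact isPiecewiseLipschitz_zero k
  · -- support
    intro k ξ hne
    by_cases hk : k = 3 ∨ k = 4
    · have hGk : G k ξ = 0 := hG0 k (by rcases hk with rfl | rfl <;> norm_num) ξ
      have hv : F₀ k ξ = if (∀ i, (41 / 250 : ℝ) ≤ ξ i ∧ ξ i < 1 / 2) ∧ ∑ i, ξ i = 1 then (-1 : ℝ) else 0 := by
        simp only [hF, hL34 k hk, hGk, add_zero]
      rw [hv] at hne
      by_cases hc : (∀ i, (41 / 250 : ℝ) ≤ ξ i ∧ ξ i < 1 / 2) ∧ ∑ i, ξ i = 1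
      · exact ⟨fun i => (hc.1 i).1, hc.2⟩
      · exact absurd (if_neg hc) hne
    · by_cases hk5 : k = 5
      · subst hk5
        rw [hF5] at hne
        exact hGsupp ξ hne
      · exact absurd (hFz k (fun h => hk (Or.inl h)) (fun h => hk (Or.inr h)) hk5 ξ) hne
  · intro x h1 h2 hs
    rw [hF3, if_pos ⟨fun i => ⟨h1 i, h2 i⟩, hs⟩]
  · intro x h1 h2 hs
    rw [hF4, if_pos ⟨fun i => ⟨h1 i, h2 i⟩, hs⟩]
  · intro x; rw [hF3]; split_ifs <;> norm_num
  · intro x; rw [hF4]; split_ifs <;> norm_num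
  · intro x; rw [hF5]; exact hG5 x
  · intro x i j hij h; rw [hF5]; exact hGpair x i j hij h
  · intro x; exact hFz 6 (by norm_num) (by norm_num) (by norm_num) x
  · simp only [hF5]; exact hI
  · intro b hb hb' hbs
    have h5' : ∀ v : Fin 3 → ℝ, F₀ (3 + 2) (Fin.append v b) = G (3 + 2) (Fin.append v b) := fun v => hF5 _
    simp only [h5']
    exact hII b hb hb' hbs

end Summit.Parity.GeneralizedHardyLittlewood.FordMaynardNoSieveConst0164NegWitness0164

end
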